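import Summits.BirchSwinnertonDyer.Rank1Residual.X11a.ChainHeightFree
import Summits.BirchSwinnertonDyer.Rank1Residual.X2.RankOne
import Summits.BirchSwinnertonDyer.Rank1Residual.Additive.QuadraticTwistSurj
import Literature.NumberTheory.EllipticCurves.CyclotomicIwasawaMainTheoremIrreducibleBaseChangeProofs
import Literature.NumberTheory.EllipticCurves.Wuthrich2014.SurjectiveMultiplicativeDivisibility
import Literature.NumberTheory.EllipticCurves.PAdicBSDSplitMultiplicativeProofs
import Literature.NumberTheory.EllipticCurves.PAdicLFunctionNonsplitMultiplicativeExistenceProofs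
import Literature.NumberTheory.EllipticCurves.ModularParametrizationTrustBaseProofs
import Literature.NumberTheory.EllipticCurves.ModularParametrizationDegreeHoldsProofs
import HarnessLib

/-!
# Class X11a, surjective leaf: the BASE-CHANGE route at a multiplicative prime — the
# Burungale–Castella–Skinner display (5.3) at `p ‖ N` as ONE typed input; Mazur's main conjecture
# INTEGRALLY from it and Kato–Wuthrich, with NO `μ`-certificate and NO (ram) prime
# (cell `b2b-bsdres`, unit `b2b-bsdres-x11a`, gen 23)

HONEST FRAMING (run/shared/lean/b2b/bsd-rank1-residual/, verbatim in every file): the goal of the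
cell is to DELETE the COMBINATION-SHAPED residual classes of the Birch–Swinnerton-Dyer formula for
ALL analytic-rank `≤ 1` elliptic curves over `ℚ` — "full BSD formula for every rank `≤ 1` curve in
class `C`" assembled STRICTLY from published theorems — so that the rank-`≤ 1` remainder becomes
exactly the CONSTRUCTION-SHAPED classes, which are TYPED (missing-input `Prop`s), NOT attempted.
This is not "finishing BSD". Research route (CLASS-CLOSURE-PLAN §3.13, experiment type E3 =
TRANSPORT by base change); NO CLAIM BEYOND STATED CLASSES. Two transparent bookkeeping definitions
and ONE typed missing input (an OPEN statement, nothing asserted, never a fact); theorems only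
otherwise; every published input is an explicit NAMED-FACT hypothesis already in the tree; nothing
is booked by this file and no label changes (cell lead / referee).

WHAT. The located gap of X11a ∩ {`p ≥ 5`, `ρ̄_{E,p}` onto} has two names on the tree so far: the
per-pair certificate `X11a.MuAnZeroAt` (residual transfer through Emerton–Pollack–Weston; class
level = Greenberg's `μ`-conjecture) and the "integral anchor on the Hida branch" (gen 21, HOME
g21/NOGO-INTEGRAL-ANCHOR.md, untyped). THIS FILE types the third, in the currency of the field's
frontier method, BASE CHANGE (Burungale–Castella–Skinner, IMRN 2025 = arXiv:2405.00270v2, §1.5,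
§5). At a GOOD ordinary prime the tree derives BCS Thm. 1.1.2 (a) from the printed display
  (5.3) `(L_p(g) L_p(g_K) L_p(g_F) L_p(g_{FK})) ⊇ ch X(g) · ch X(g_K) · ch X(g_F) · ch X(g_{FK})`
(the newforms of `E` and of its twists `E^{d_K}, E^{d_F}, E^{d_K d_F}`, `K` imaginary / `F` real
quadratic; from Prop. 5.2.1 = Wan's family divisibility over `M = FK` descended to the cyclotomic
line) and Kato for the four curves ("a proper divisibility in (5.4) would contradict (5.3)"):
`Literature/…/CyclotomicIwasawaMainTheoremIrreducibleBaseChangeProofs.lean`, hypothesis `h53`. At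
`p ‖ N` the display is NOT in print (Prop. 5.2.1 / Thm. 3.2.1 are printed for good ordinary `p`;
integrality there rests on Hsieh's `μ(L_p^{BDP}) = 0`, `p ∤ N`, and BSTW's zeta element, `p ∤ 2N`,
preprint), so here it is the TYPED MISSING INPUT `X11a.BaseChangeLowerBoundAt W p` — the shape of
`h53`, but INTEGRAL, Néron-normalised as `X2.MazurMainConjectureAt` (`ϖ · Ω_E = Ω⁺_f`), with THE
multiplicative Mazur–Tate–Teitelbaum function of each curve and its trivial-zero factor
(`IsTheMultPAdicLFunctionOf`, `trivialZeroFactor`). Theorems: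
* `isUnit_of_prod_mem_span` — BCS's closing sentence as integral algebra in a domain;
* `kato_trivialZeroFactor` — Kato–Wuthrich A32 in the uniform shape `ι(T^e k) = ϖ L`, `k ∈ ch X`;
* **`mazurMainConjectureAt_of_baseChangeLowerBound`**: `p ≥ 5` multiplicative, `ρ̄_{E,p}` onto,
  `BaseChangeLowerBoundAt W p` ⇒ `X2.MazurMainConjectureAt W p`, the three twists being handled from
  tree theorems (globally minimal models, multiplicative at `p` as `p ∤ d`, `ρ̄` onto by twist
  invariance hence at every level `p^n` by Serre, newform + `ϖᵢ` from the modular parametrisation,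
  THE `p`-adic `L`-function, Selmer data, principal nonzero characteristic ideals);
* **`bsdp_of_baseChangeLowerBound`**: on X11a at `p ≥ 5` with `ρ̄_{E,p}` onto, `BSD(E,p)` ⇐ the typed input + A32 + Stein–Wuthrich Thm. 6.1 ×2 +
  Greenberg–Stevens + GZK + modularity — NO `μ`-certificate, no EPW / Hida family / Wan Thm. 4, and
  NO (ram): BCS's `K`, `F` are UNRAMIFIED at every `ℓ ∣ N` (split in `K` by (Heeg); split or inert in
  `F` by Prop. 5.2.1 (iii)), so no additive prime of `E` becomes multiplicative over `K`, `F`, `KF`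
  — the (ram)-acquisition idea of RESIDUAL-MAP §C is not what the base-change method uses.
WHY the INTEGRAL display (CLASS-CLOSURE-PLAN §1 item 5, "the comparison statement the transport
needs"): the RATIONAL one (powers of `p`, as `h53`) plus Kato integral only gives
`T^e · ch X = (p^{-k} ϖL)` with `k ≥ 0`, and `k = 0` needs the certificate `μ^an(E,p) = 0` again
(`μ(ϖL) = k + μ(ch X)`); the integral display is what a "BCS at multiplicative primes" theorem
would print (Wan 2015 Thm. 3 is a statement for the whole Hida family `𝕀`, BCS Thm. 3.2.1 proof;
missing in print at `p ‖ N`: the Steinberg specialisation/control [SU14 (3.5)] for Wan's Selmer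
groups over `M_∞`, and the integrality step Props. 4.1.3/4.2.2 — gen 21 census). The per-pair
`μ`-certificate route of record (`forall_bsdp_of_namedFacts_ofLevel_heightFree`) is untouched.

References: [BurungaleCastellaSkinner2025] Thm. 1.1.2, §1.5, Thm. 3.2.1, Prop. 5.2.1, Lemma 5.2.3, proof of
Thm. 1.1.2 with (5.3)–(5.4) (arXiv:2405.00270v2 pp. 2, 5, 7, 9–10); [Wuthrich2014] Thm. 3, Cor. 19;
[Skinner2016PacificMC] §3.2–3.3; [SteinWuthrich2013] Thm. 6.1; HOME/b2b-bsdres-x11a/REPORT-g23.md.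
-/

set_option autoImplicit false

noncomputable section

open scoped Classical MatrixGroups ModularForm

open CongruenceSubgroup WeierstrassCurve Literature.NumberTheory.EllipticCurves
  Literature.NumberTheory.EllipticCurves.ModularForms
  Literature.NumberTheory.EllipticCurves.Rank1Residual
  Literature.NumberTheory.EllipticCurves.Rank1Residual.Typed
  Literature.NumberTheory.EllipticCurves.Wuthrich2014
  Literature.NumberTheory.EllipticCurves.SteinWuthrich2013

namespace Summit.BirchSwinnertonDyer.Rank1Residual.X11a

section Bookkeeping

variable (W : WeierstrassCurve ℚ) {N : ℕ} [NeZero N]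
  (f : CuspForm (Gamma0 N) 2) (p : ℕ) [Fact p.Prime]

/-- **THE multiplicative Mazur–Tate–Teitelbaum function of `(E, f)` at `p`**, uniformly in the
split type: THE split-multiplicative function (`IsSplitMultPAdicLFunctionOf f p L`) if `E` is split
at `p`, THE non-split one (`IsMultPAdicLFunctionOf f p (-1) L`) otherwise — the two `L`'s quantified
in `X2.MazurMainConjectureAt` and in A32. Transparent bookkeeping. [folklore] -/
def IsTheMultPAdicLFunctionOf (L : PowerSeries ℚ_[p]) : Prop :=
  (W.HasSplitMultiplicativeReductionAtPrime p → IsSplitMultPAdicLFunctionOf f p L) ∧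
    (¬ W.HasSplitMultiplicativeReductionAtPrime p → IsMultPAdicLFunctionOf f p (-1) L)

/-- **The trivial-zero factor `T^e ∈ Λ`**: `T` if `E` is split multiplicative at `p` (`e = 1`, the
exceptional zero of `L_p(E,T)` relative to the classical Selmer group, Skinner 2016 §3.2), `1`
otherwise — the factor of `X2.MazurMainConjectureAt`. [cite: Skinner2016PacificMC, §3.2 (shape only)] -/
def trivialZeroFactor : IwasawaAlgebra p :=
  if W.HasSplitMultiplicativeReductionAtPrime p then PowerSeries.X else 1

/-- The trivial-zero factor is `T` at a split prime. [folklore] -/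
theorem trivialZeroFactor_of_split (h : W.HasSplitMultiplicativeReductionAtPrime p) :
    trivialZeroFactor W p = PowerSeries.X := by simp [trivialZeroFactor, h]

/-- The trivial-zero factor is `1` at a non-split prime. [folklore] -/
theorem trivialZeroFactor_of_not_split (h : ¬ W.HasSplitMultiplicativeReductionAtPrime p) :
    trivialZeroFactor W p = 1 := by simp [trivialZeroFactor, h]

/-- The trivial-zero factor is nonzero in the domain `Λ = ℤ_p⟦T⟧`. [folklore] -/
theorem trivialZeroFactor_ne_zero : trivialZeroFactor W p ≠ 0 := by
  by_cases h : W.HasSplitMultiplicativeReductionAtPrime p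
  · rw [trivialZeroFactor_of_split W p h]; exact PowerSeries.X_ne_zero
  · rw [trivialZeroFactor_of_not_split W p h]; exact one_ne_zero

/-- THE multiplicative function exists (tree theorems `exists_isSplitMultPAdicLFunctionOf`,
`exists_isMultPAdicLFunctionOf_neg_one_of_nonsplit`: Riemann sums of the plus modular symbol).
[cite: MazurTateTeitelbaum1986, §I.10 and §I.14] -/
theorem exists_isTheMultPAdicLFunctionOf (hf : IsNewformOf W f)
    (hmult : W.HasMultiplicativeReductionAtPrime p) :
    ∃ L : PowerSeries ℚ_[p], IsTheMultPAdicLFunctionOf W f p L := by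
  by_cases hs : W.HasSplitMultiplicativeReductionAtPrime p
  · obtain ⟨L, hL⟩ := exists_isSplitMultPAdicLFunctionOf hs hf
    exact ⟨L, fun _ => hL, fun h => (h hs).elim⟩
  · obtain ⟨L, hL⟩ := exists_isMultPAdicLFunctionOf_neg_one_of_nonsplit hf hmult hs
    exact ⟨L, fun h => (hs h).elim, fun _ => hL⟩

end Bookkeeping

/-- **Kato–Wuthrich's integral divisibility (A32) in the uniform shape**: `W/ℚ` globally minimal,
multiplicative at the odd prime `p`, every `ρ̄_{E,p^n}` onto, cyclotomic `(κ, γ)`, a newform `f` of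
`W`, a dual datum `D`, `ϖ · Ω_E = Ω⁺_f`, THE multiplicative function `L`: `X` is torsion and some
`k ∈ ch X` has `ι(T^e · k) = ϖ · L` (`T^e` = `trivialZeroFactor`). A32's two clauses merged.
[cite: Wuthrich2014, Thm. 3 (p. 383) and Cor. 19 with proof (pp. 398–399)] [cite: Kato2004Asterisque, Thm. 17.4] -/
theorem kato_trivialZeroFactor (hKato : kato_charIdeal_dvd_multiplicative_of_surjective)
    (W : WeierstrassCurve ℚ) [W.IsElliptic] [W.IsGloballyMinimal] (p : ℕ) [Fact p.Prime]
    {κ : ZpExtension ℚ p} {γ : Field.absoluteGaloisGroup ℚ} {N : ℕ} [NeZero N]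
    {f : CuspForm (Gamma0 N) 2} (hp2 : p ≠ 2) (hmult : W.HasMultiplicativeReductionAtPrime p)
    (hsurj' : ∀ n : ℕ, W.HasSurjectiveModNGaloisRep (p ^ n : ℕ)) (hκ : κ.IsCyclotomic)
    (hγ : κ.IsTopGenerator γ) (hγ' : IsCyclotomicVariable p γ) (hf : IsNewformOf W f)
    (D : W.SelmerDualData κ γ) (ϖ : ℚ) (hϖ : (ϖ : ℝ) * W.realPeriodRat = plusPeriod f)
    (L : PowerSeries ℚ_[p]) (hL : IsTheMultPAdicLFunctionOf W f p L) :
    D.IsTorsion ∧ ∃ k ∈ D.charIdeal,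
      iwasawaToPowerSeries p (trivialZeroFactor W p * k) = PowerSeries.C ((ϖ : ℚ) : ℚ_[p]) * L := by
  obtain ⟨hX, hKns, hKs⟩ := hKato W p hp2 hmult hsurj' hκ hγ hγ' hf D ϖ hϖ
  refine ⟨hX, ?_⟩
  by_cases hs : W.HasSplitMultiplicativeReductionAtPrime p
  · obtain ⟨k, hk, hι⟩ := hKs hs L (hL.1 hs)
    exact ⟨k, hk, by rw [trivialZeroFactor_of_split W p hs]; exact hι⟩
  · obtain ⟨k, hk, hι⟩ := hKns hs L (hL.2 hs)
    exact ⟨k, hk, by rw [trivialZeroFactor_of_not_split W p hs, one_mul]; exact hι⟩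

/-- **Typed OPEN input of the base-change route on class X11a (nothing asserted; never a fact): the
Burungale–Castella–Skinner display (5.3) at a MULTIPLICATIVE prime, INTEGRALLY, Néron-normalised.**
For the cyclotomic data `(κ, γ)` and every newform `f` of the globally minimal `W`, there are
integers `d_K < 0`, `d_F > 1` — squarefree, `≡ 1 (mod 4)`, `d_K ≠ -3`, coprime, `d_K d_F` prime
to `pN`, `d_K` a square and `d_F` a non-square mod `p` (the fields of BCS Lemma 5.2.3, recorded
exactly as in the tree's transcription `h53` of the good-ordinary display) — such that for all
globally minimal models `W₁, W₂, W₃` of `E^{d_K}, E^{d_F}, E^{d_K d_F}`, their newforms, all dual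
data `D, D₁, D₂, D₃` over `(κ, γ)`, all `ϖᵢ ∈ ℚ` with `ϖᵢ · Ω_{Eᵢ} = Ω⁺_{fᵢ}` and THE multiplicative
Mazur–Tate–Teitelbaum functions `L, L₁, L₂, L₃`: some `G ∈ Λ` has `ι G = (ϖ ϖ₁ ϖ₂ ϖ₃) · L L₁ L₂ L₃`
and `(T^{e+e₁+e₂+e₃}) · ch X · ch X₁ · ch X₂ · ch X₃ ⊆ (G)` — "(5.3) in `Λ`" read at `p ‖ N`
through Skinner 2016 §3.2–3.3 (classical Selmer groups, trivial zero carried by `L`, canonical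
period = `ϖ`-normalisation up to `ℤ_p^×`). STATUS: OPEN at `p ‖ N` (good-ordinary twin PRINTED:
BCS Prop. 5.2.1 + (5.3) = the tree's `h53`; see the module docstring); on X11a it REPLACES the
per-pair `μ`-certificate by ONE class-level statement (`bsdp_of_baseChangeLowerBound`).
[cite: BurungaleCastellaSkinner2025, display (5.3) and "Proof of Theorem 1.1.2" (arXiv:2405.00270v2 p. 10), Lemma 5.2.3, Prop. 5.2.1 (p. 9) (shape only; nothing asserted)]
[cite: Skinner2016PacificMC, §3.2–3.3 (shape only)] -/
def BaseChangeLowerBoundAt (W : WeierstrassCurve ℚ) [W.IsElliptic] [W.IsGloballyMinimal] (p : ℕ)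
    [Fact p.Prime] : Prop :=
  ∀ (κ : ZpExtension ℚ p) (γ : Field.absoluteGaloisGroup ℚ),
      κ.IsCyclotomic → κ.IsTopGenerator γ → IsCyclotomicVariable p γ →
    ∀ {N : ℕ} [NeZero N] (f : CuspForm (Gamma0 N) 2), IsNewformOf W f →
    ∃ dK dF : ℤ,
      dK < 0 ∧ dK % 4 = 1 ∧ Squarefree dK ∧ dK ≠ -3 ∧
      1 < dF ∧ dF % 4 = 1 ∧ Squarefree dF ∧ IsCoprime dK dF ∧
      IsCoprime (dK * dF) (p * N) ∧
      IsSquare ((dK : ZMod p)) ∧ ¬ IsSquare ((dF : ZMod p)) ∧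
      ∀ (W₁ W₂ W₃ : WeierstrassCurve ℚ) [W₁.IsElliptic] [W₁.IsGloballyMinimal]
        [W₂.IsElliptic] [W₂.IsGloballyMinimal] [W₃.IsElliptic] [W₃.IsGloballyMinimal]
        (_ : ∃ C : VariableChange ℚ, C • W₁ = W.quadraticTwist (dK : ℚ))
        (_ : ∃ C : VariableChange ℚ, C • W₂ = W.quadraticTwist (dF : ℚ))
        (_ : ∃ C : VariableChange ℚ, C • W₃ = W.quadraticTwist ((dK * dF : ℤ) : ℚ))
        {N₁ N₂ N₃ : ℕ} [NeZero N₁] [NeZero N₂] [NeZero N₃]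
        (f₁ : CuspForm (Gamma0 N₁) 2) (f₂ : CuspForm (Gamma0 N₂) 2)
        (f₃ : CuspForm (Gamma0 N₃) 2),
        IsNewformOf W₁ f₁ → IsNewformOf W₂ f₂ → IsNewformOf W₃ f₃ →
      ∀ (D : W.SelmerDualData κ γ) (D₁ : W₁.SelmerDualData κ γ) (D₂ : W₂.SelmerDualData κ γ)
        (D₃ : W₃.SelmerDualData κ γ) (ϖ ϖ₁ ϖ₂ ϖ₃ : ℚ),
        (ϖ : ℝ) * W.realPeriodRat = plusPeriod f → (ϖ₁ : ℝ) * W₁.realPeriodRat = plusPeriod f₁ →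
        (ϖ₂ : ℝ) * W₂.realPeriodRat = plusPeriod f₂ → (ϖ₃ : ℝ) * W₃.realPeriodRat = plusPeriod f₃ →
      ∀ (L L₁ L₂ L₃ : PowerSeries ℚ_[p]),
        IsTheMultPAdicLFunctionOf W f p L → IsTheMultPAdicLFunctionOf W₁ f₁ p L₁ →
        IsTheMultPAdicLFunctionOf W₂ f₂ p L₂ → IsTheMultPAdicLFunctionOf W₃ f₃ p L₃ →
      ∃ G : IwasawaAlgebra p,
        iwasawaToPowerSeries p G =
            PowerSeries.C (((ϖ * ϖ₁ * ϖ₂ * ϖ₃ : ℚ) : ℚ_[p])) * (L * L₁ * L₂ * L₃) ∧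
          Ideal.span {trivialZeroFactor W p * trivialZeroFactor W₁ p * trivialZeroFactor W₂ p *
              trivialZeroFactor W₃ p} *
            (D.charIdeal * D₁.charIdeal * D₂.charIdeal * D₃.charIdeal) ≤ Ideal.span {G}

/-- **Pure algebra (integral form of BCS's closing sentence, four factors with trivial-zero
factors).** In a domain `R`: if `t = t₀t₁t₂t₃ ≠ 0`, `c₀c₁c₂c₃ ≠ 0` and
`t · c₀c₁c₂c₃ ∈ (t₀h₀c₀ · t₁h₁c₁ · t₂h₂c₂ · t₃h₃c₃)`, then every `hᵢ` is a unit (cancel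
`t · ∏ cᵢ`: `1 = a · ∏ hᵢ`). [folklore] -/
theorem isUnit_of_prod_mem_span {R : Type*} [CommRing R] [IsDomain R]
    {t₀ t₁ t₂ t₃ c₀ c₁ c₂ c₃ h₀ h₁ h₂ h₃ : R}
    (ht : t₀ * t₁ * t₂ * t₃ ≠ 0) (hc : c₀ * c₁ * c₂ * c₃ ≠ 0)
    (hmem : t₀ * t₁ * t₂ * t₃ * (c₀ * c₁ * c₂ * c₃) ∈
      Ideal.span {t₀ * (h₀ * c₀) * (t₁ * (h₁ * c₁)) * (t₂ * (h₂ * c₂)) * (t₃ * (h₃ * c₃))}) :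
    IsUnit h₀ ∧ IsUnit h₁ ∧ IsUnit h₂ ∧ IsUnit h₃ := by
  obtain ⟨a, ha⟩ := Ideal.mem_span_singleton'.mp hmem
  have hne : t₀ * t₁ * t₂ * t₃ * (c₀ * c₁ * c₂ * c₃) ≠ 0 := mul_ne_zero ht hc
  have key : a * (h₀ * h₁ * h₂ * h₃) * (t₀ * t₁ * t₂ * t₃ * (c₀ * c₁ * c₂ * c₃)) =
      1 * (t₀ * t₁ * t₂ * t₃ * (c₀ * c₁ * c₂ * c₃)) := by
    linear_combination ha
  have h1 : a * (h₀ * h₁ * h₂ * h₃) = 1 := mul_right_cancel₀ hne key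
  have hu : IsUnit (h₀ * h₁ * h₂ * h₃) := IsUnit.of_mul_eq_one a (by rw [mul_comm]; exact h1)
  rw [IsUnit.mul_iff, IsUnit.mul_iff, IsUnit.mul_iff] at hu
  exact ⟨hu.1.1.1, hu.1.1.2, hu.1.2, hu.2⟩

section Main

variable (W : WeierstrassCurve ℚ) [W.IsElliptic] [W.IsGloballyMinimal] (p : ℕ) [Fact p.Prime]

/-- **Mazur's main conjecture at a multiplicative `p ≥ 5` with surjective `ρ̄_{E,p}`, INTEGRALLY,
from the base-change display and Kato–Wuthrich — no `μ`-certificate, no (ram).** Hypotheses: the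
PUBLISHED named facts A32 (`hKato`) and modularity as `nonempty_modularParametrizationData` (`hpar`,
used only to attach newforms and period ratios `ϖᵢ` to the three twists); `p ≥ 5`, `E`
multiplicative at `p`, `ρ̄_{E,p}` onto; the typed OPEN input `BaseChangeLowerBoundAt W p`. Proof =
BCS's "Proof of Theorem 1.1.2" read at a multiplicative prime and integrally: globally minimal models
of the twists (multiplicative at `p` since `p ∤ d_K d_F`; `ρ̄` onto by twist invariance, so every
`ρ̄_{·,p^n}` onto by Serre), their newforms, `ϖᵢ`, Selmer data, THE `p`-adic `L`-functions; A32 for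
the four curves gives `kᵢ = hᵢ cᵢ ∈ ch Xᵢ = (cᵢ)` with `ι(T^{eᵢ} kᵢ) = ϖᵢ Lᵢ`; injectivity of `ι`
makes the display's `G` equal `∏ T^{eᵢ} hᵢ cᵢ`, and `∏ T^{eᵢ} ∏ cᵢ ∈ (G)` forces each `hᵢ` to be
a unit (`isUnit_of_prod_mem_span`); `h₀` is the unit of Mazur's statement for `E`.
[cite: BurungaleCastellaSkinner2025, "Proof of Theorem 1.1.2" with (5.3)–(5.4) (arXiv:2405.00270v2 p. 10)]
[cite: Wuthrich2014, Thm. 3 and Cor. 19 (pp. 383, 398–399)] [cite: SerreAbelianLadic1968, Ch. IV §3.4]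
[cite: SilvermanAEC2009, VII.5 Prop. 5.1(b), VIII.8 Cor. 8.3, X.5 Cor. 5.4] -/
theorem mazurMainConjectureAt_of_baseChangeLowerBound
    (hKato : kato_charIdeal_dvd_multiplicative_of_surjective)
    (hpar : nonempty_modularParametrizationData)
    (hp : 5 ≤ p) (hmult : W.HasMultiplicativeReductionAtPrime p) (hsurj : Surj W p)
    (hBC : BaseChangeLowerBoundAt W p) : X2.MazurMainConjectureAt W p := by
  intro κ γ hκ hγ hγ' N _ f hf D ϖ hϖ
  have hpP : p.Prime := Fact.out
  have hp2 : p ≠ 2 := by omega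
  have hpZ : Prime (p : ℤ) := Nat.prime_iff_prime_int.mp hpP
  obtain ⟨dK, dF, hK0, -, hKsq, -, hF1, -, hFsq, hKF, hcop, -, -, H⟩ := hBC κ γ hκ hγ hγ' f hf
  have hpunit : ¬ IsUnit (p : ℤ) := by
    rw [Int.isUnit_iff_natAbs_eq, Int.natAbs_natCast]
    exact hpP.one_lt.ne'
  have hpK : ¬ (p : ℤ) ∣ dK := fun h =>
    hpunit (hcop.isUnit_of_dvd' (dvd_mul_of_dvd_left h _) (dvd_mul_right _ _))
  have hpF : ¬ (p : ℤ) ∣ dF := fun h =>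
    hpunit (hcop.isUnit_of_dvd' (dvd_mul_of_dvd_right h _) (dvd_mul_right _ _))
  have hpKF : ¬ (p : ℤ) ∣ dK * dF := fun h => (hpZ.dvd_or_dvd h).elim hpK hpF
  have hF0 : dF ≠ 0 := by omega
  have hK0' : (dK : ℚ) ≠ 0 := by exact_mod_cast hK0.ne
  have hF0' : (dF : ℚ) ≠ 0 := by exact_mod_cast hF0
  have hKF0' : ((dK * dF : ℤ) : ℚ) ≠ 0 := by exact_mod_cast mul_ne_zero hK0.ne hF0
  obtain ⟨W₁, hE₁, hM₁, C₁, hC₁⟩ := exists_isGloballyMinimal_smul_eq_quadraticTwist W hK0'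
  obtain ⟨W₂, hE₂, hM₂, C₂, hC₂⟩ := exists_isGloballyMinimal_smul_eq_quadraticTwist W hF0'
  obtain ⟨W₃, hE₃, hM₃, C₃, hC₃⟩ := exists_isGloballyMinimal_smul_eq_quadraticTwist W hKF0'
  have hm₁ : W₁.HasMultiplicativeReductionAtPrime p :=
    X2.hasMultiplicativeReductionAtPrime_of_smul_eq_quadraticTwist W W₁ hC₁ p hp2 hpK hmult
  have hm₂ : W₂.HasMultiplicativeReductionAtPrime p :=
    X2.hasMultiplicativeReductionAtPrime_of_smul_eq_quadraticTwist W W₂ hC₂ p hp2 hpF hmult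
  have hm₃ : W₃.HasMultiplicativeReductionAtPrime p :=
    X2.hasMultiplicativeReductionAtPrime_of_smul_eq_quadraticTwist W W₃ hC₃ p hp2 hpKF hmult
  -- `ρ̄` onto for the twists (twist invariance), hence onto at every level `p^n` (Serre, `p ≥ 5`)
  have hs₀ : ∀ n : ℕ, W.HasSurjectiveModNGaloisRep (p ^ n : ℕ) :=
    kato_charIdeal_dvd_multiplicative_of_surjective.surjective_pow_of_five_le W p hp hsurj
  have hs₁ : ∀ n : ℕ, W₁.HasSurjectiveModNGaloisRep (p ^ n : ℕ) :=
    kato_charIdeal_dvd_multiplicative_of_surjective.surjective_pow_of_five_le W₁ p hp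
      ((Additive.surj_iff_of_model_twist W p hK0' ⟨C₁⁻¹, by rw [← hC₁, inv_smul_smul]⟩).mpr hsurj)
  have hs₂ : ∀ n : ℕ, W₂.HasSurjectiveModNGaloisRep (p ^ n : ℕ) :=
    kato_charIdeal_dvd_multiplicative_of_surjective.surjective_pow_of_five_le W₂ p hp
      ((Additive.surj_iff_of_model_twist W p hF0' ⟨C₂⁻¹, by rw [← hC₂, inv_smul_smul]⟩).mpr hsurj)
  have hs₃ : ∀ n : ℕ, W₃.HasSurjectiveModNGaloisRep (p ^ n : ℕ) :=
    kato_charIdeal_dvd_multiplicative_of_surjective.surjective_pow_of_five_le W₃ p hp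
      ((Additive.surj_iff_of_model_twist W p hKF0' ⟨C₃⁻¹, by rw [← hC₃, inv_smul_smul]⟩).mpr hsurj)
  haveI : NeZero (W₁.conductorNorm ℤ) := ⟨(W₁.conductorNorm_pos_holds).ne'⟩
  haveI : NeZero (W₂.conductorNorm ℤ) := ⟨(W₂.conductorNorm_pos_holds).ne'⟩
  haveI : NeZero (W₃.conductorNorm ℤ) := ⟨(W₃.conductorNorm_pos_holds).ne'⟩
  obtain ⟨Dm₁⟩ := hpar W₁
  obtain ⟨Dm₂⟩ := hpar W₂
  obtain ⟨Dm₃⟩ := hpar W₃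
  obtain ⟨ϖ₁, hϖ₁pos, hϖ₁, -⟩ := Dm₁.exists_rat_mul_realPeriodRat_eq_plusPeriod
  obtain ⟨ϖ₂, hϖ₂pos, hϖ₂, -⟩ := Dm₂.exists_rat_mul_realPeriodRat_eq_plusPeriod
  obtain ⟨ϖ₃, hϖ₃pos, hϖ₃, -⟩ := Dm₃.exists_rat_mul_realPeriodRat_eq_plusPeriod
  set D₁ : W₁.SelmerDualData κ γ := W₁.selmerDualData κ hγ with hD₁
  set D₂ : W₂.SelmerDualData κ γ := W₂.selmerDualData κ hγ with hD₂
  set D₃ : W₃.SelmerDualData κ γ := W₃.selmerDualData κ hγ with hD₃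
  obtain ⟨L₁, hL₁⟩ := exists_isTheMultPAdicLFunctionOf W₁ Dm₁.f p Dm₁.isNewformOf hm₁
  obtain ⟨L₂, hL₂⟩ := exists_isTheMultPAdicLFunctionOf W₂ Dm₂.f p Dm₂.isNewformOf hm₂
  obtain ⟨L₃, hL₃⟩ := exists_isTheMultPAdicLFunctionOf W₃ Dm₃.f p Dm₃.isNewformOf hm₃
  obtain ⟨-, k₁, hk₁, hι₁⟩ := kato_trivialZeroFactor hKato W₁ p hp2 hm₁ hs₁ hκ hγ hγ' Dm₁.isNewformOf
    D₁ ϖ₁ hϖ₁ L₁ hL₁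
  obtain ⟨-, k₂, hk₂, hι₂⟩ := kato_trivialZeroFactor hKato W₂ p hp2 hm₂ hs₂ hκ hγ hγ' Dm₂.isNewformOf
    D₂ ϖ₂ hϖ₂ L₂ hL₂
  obtain ⟨-, k₃, hk₃, hι₃⟩ := kato_trivialZeroFactor hKato W₃ p hp2 hm₃ hs₃ hκ hγ hγ' Dm₃.isNewformOf
    D₃ ϖ₃ hϖ₃ L₃ hL₃
  obtain ⟨c₀, hc₀, hc₀0⟩ := exists_charIdeal_eq_span_singleton p D
  obtain ⟨c₁, hc₁, hc₁0⟩ := exists_charIdeal_eq_span_singleton p D₁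
  obtain ⟨c₂, hc₂, hc₂0⟩ := exists_charIdeal_eq_span_singleton p D₂
  obtain ⟨c₃, hc₃, hc₃0⟩ := exists_charIdeal_eq_span_singleton p D₃
  rw [hc₁] at hk₁
  rw [hc₂] at hk₂
  rw [hc₃] at hk₃
  obtain ⟨h₁, rfl⟩ := Ideal.mem_span_singleton'.mp hk₁
  obtain ⟨h₂, rfl⟩ := Ideal.mem_span_singleton'.mp hk₂
  obtain ⟨h₃, rfl⟩ := Ideal.mem_span_singleton'.mp hk₃
  -- the core: for THE function `L` of `W` and its Kato element, `h₀` is a unit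
  have core : ∀ (L : PowerSeries ℚ_[p]), IsTheMultPAdicLFunctionOf W f p L →
      ∃ w : (IwasawaAlgebra p)ˣ,
        iwasawaToPowerSeries p (trivialZeroFactor W p * c₀ * (w : IwasawaAlgebra p)) =
          PowerSeries.C ((ϖ : ℚ) : ℚ_[p]) * L := by
    intro L hL
    obtain ⟨-, k₀, hk₀, hι₀⟩ := kato_trivialZeroFactor hKato W p hp2 hmult hs₀ hκ hγ hγ' hf D ϖ hϖ L hL
    rw [hc₀] at hk₀
    obtain ⟨h₀, rfl⟩ := Ideal.mem_span_singleton'.mp hk₀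
    obtain ⟨G, hιG, hG⟩ := H W₁ W₂ W₃ ⟨C₁, hC₁⟩ ⟨C₂, hC₂⟩ ⟨C₃, hC₃⟩ Dm₁.f Dm₂.f Dm₃.f
      Dm₁.isNewformOf Dm₂.isNewformOf Dm₃.isNewformOf D D₁ D₂ D₃ ϖ ϖ₁ ϖ₂ ϖ₃ hϖ hϖ₁ hϖ₂ hϖ₃
      L L₁ L₂ L₃ hL hL₁ hL₂ hL₃
    set t₀ := trivialZeroFactor W p with ht₀
    set t₁ := trivialZeroFactor W₁ p with ht₁
    set t₂ := trivialZeroFactor W₂ p with ht₂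
    set t₃ := trivialZeroFactor W₃ p with ht₃
    have hinj := iwasawaToPowerSeries_injective p
    have hGeq : G = t₀ * (h₀ * c₀) * (t₁ * (h₁ * c₁)) * (t₂ * (h₂ * c₂)) * (t₃ * (h₃ * c₃)) := by
      apply hinj
      rw [hιG, map_mul, map_mul, map_mul, hι₀, hι₁, hι₂, hι₃]
      push_cast
      simp only [map_mul]
      ring
    have hmem : t₀ * t₁ * t₂ * t₃ * (c₀ * c₁ * c₂ * c₃) ∈
        Ideal.span {t₀ * (h₀ * c₀) * (t₁ * (h₁ * c₁)) * (t₂ * (h₂ * c₂)) * (t₃ * (h₃ * c₃))} := by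
      rw [← hGeq]
      refine hG (Ideal.mul_mem_mul (Ideal.mem_span_singleton_self _) ?_)
      refine Ideal.mul_mem_mul (Ideal.mul_mem_mul (Ideal.mul_mem_mul ?_ ?_) ?_) ?_
      · rw [hc₀]; exact Ideal.mem_span_singleton_self _
      · rw [hc₁]; exact Ideal.mem_span_singleton_self _
      · rw [hc₂]; exact Ideal.mem_span_singleton_self _
      · rw [hc₃]; exact Ideal.mem_span_singleton_self _
    have ht : t₀ * t₁ * t₂ * t₃ ≠ 0 :=
      mul_ne_zero (mul_ne_zero (mul_ne_zero (trivialZeroFactor_ne_zero W p)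
        (trivialZeroFactor_ne_zero W₁ p)) (trivialZeroFactor_ne_zero W₂ p))
        (trivialZeroFactor_ne_zero W₃ p)
    have hc : c₀ * c₁ * c₂ * c₃ ≠ 0 :=
      mul_ne_zero (mul_ne_zero (mul_ne_zero hc₀0 hc₁0) hc₂0) hc₃0
    obtain ⟨hu₀, -, -, -⟩ := isUnit_of_prod_mem_span ht hc hmem
    refine ⟨hu₀.unit, ?_⟩
    rw [IsUnit.unit_spec, ← hι₀]
    congr 1
    ring
  obtain ⟨hX, -⟩ := hKato W p hp2 hmult hs₀ hκ hγ hγ' hf D ϖ hϖ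
  refine ⟨hX, c₀, hc₀, fun hsplit L hL => ?_, fun hns L hL => ?_⟩
  · obtain ⟨w, hw⟩ := core L ⟨fun _ => hL, fun h => (h hsplit).elim⟩
    refine ⟨w, ?_⟩
    rw [← hw, trivialZeroFactor_of_split W p hsplit]
  · obtain ⟨w, hw⟩ := core L ⟨fun h => (hns h).elim, fun _ => hL⟩
    refine ⟨w, ?_⟩
    rw [← hw, trivialZeroFactor_of_not_split W p hns, one_mul]

/-- **`BSD(E,p)` on class X11a at `p ≥ 5` with surjective `ρ̄_{E,p}` from the base-change display
— NO `μ`-certificate, NO (ram).** Inputs: the typed OPEN input `BaseChangeLowerBoundAt W p`; the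
PUBLISHED named facts Kato–Wuthrich A32 (`hKato`), Stein–Wuthrich 2013 Thm. 6.1 split / non-split
(`hJs`, `hJn`), Greenberg–Stevens (`hGS`), Gross–Zagier–Kolyvagin (`hGZK`), modularity counted once
(`hNf : exists_isNewformOf`; analytic continuation and the parametrisation datum are its tree
consequences, as in `X11a/EndState.lean`). Glue: `mazurMainConjectureAt_of_baseChangeLowerBound` +
`bsdp_of_mazurMainConjectureAt_heightFree`. Compare the chain of record
`forall_bsdp_of_namedFacts_ofLevel_heightFree` (12 named facts + the per-pair `MuAnZeroAt`): here 6
named facts + ONE class-level open input. Nothing booked; no label change.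
[cite: BurungaleCastellaSkinner2025, "Proof of Theorem 1.1.2" with (5.3) (arXiv:2405.00270v2 p. 10)]
[cite: SteinWuthrich2013, Thm. 6.1 (p. 20)] [cite: Wuthrich2014, Thm. 3 and Cor. 19] -/
theorem bsdp_of_baseChangeLowerBound (hNf : exists_isNewformOf)
    (hKato : kato_charIdeal_dvd_multiplicative_of_surjective)
    (hJs : thm61_splitMultiplicative) (hJn : thm61_nonsplitMultiplicative)
    (hGZK : rank_eq_analyticRank_of_analyticRank_le_one)
    (hGS : greenberg_stevens (W := W) (p := p))
    (hX : ClassX11a W p) (hp : 5 ≤ p) (hsurj : Surj W p) (hBC : BaseChangeLowerBoundAt W p) :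
    BSDp W p :=
  bsdp_of_mazurMainConjectureAt_heightFree hJs hJn hGZK (hasEntireLFunction_rat_of_exists_isNewformOf hNf)
    (nonempty_modularParametrizationData_of_exists_isNewformOf hNf
      IsNewformOf.exists_maninConstant_ne_zero_holds) hGS hX
    (mazurMainConjectureAt_of_baseChangeLowerBound W p hKato
      (nonempty_modularParametrizationData_of_exists_isNewformOf hNf
        IsNewformOf.exists_maninConstant_ne_zero_holds) hp hX.mult hsurj hBC)

end Main

end Summit.BirchSwinnertonDyer.Rank1Residual.X11a

end
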